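import Mathlib.AlgebraicGeometry.IdealSheaf.Basic
import HarnessLib

/-!
# Support of a finite product of ideal sheaves

Support file for crux stmt-ResolutionOfSingularities-15315
(`FrobeniusLadder.FInjectiveMacaulayfication`, line `Sketch`, seat c6): stub
`stub_supportFinsetProd`.

The surgery glue of the F-injective Macaulayfication line blows up the product
`∏_{b ∈ T} J b` of finitely many point-supported centres and needs
`supp (∏_{b ∈ T} J b) = ⋃_{b ∈ T} supp (J b)`.

Proof: induction on the finset. The empty product is `1 = ⊤`
(`Scheme.IdealSheafData.one_eq_top`), whose support is `⊥ = ∅`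
(`Scheme.IdealSheafData.support_top`), and the empty union is `∅`; the insertion step is
`Finset.prod_insert`, the multiplicativity `(I * J).support = I.support ⊔ J.support`
(`Scheme.IdealSheafData.support_mul`) and `Finset.set_biUnion_insert`.

References: folklore bookkeeping over Mathlib's `Scheme.IdealSheafData` API (the
`IdemCommSemiring` structure and `support`); no definition is declared. [folklore]
-/

-- single-problem summit: the doubled namespace component `ResolutionOfSingularities` is forced
set_option linter.dupNamespace false

noncomputable section

namespace Summit.ResolutionOfSingularities.ResolutionOfSingularities.Theorems.FInjectiveMacaulayfication.SupportFinsetProd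

open AlgebraicGeometry CategoryTheory

/-- **Support of a finite product of ideal sheaves.** For a scheme `X` and a finite family
`J i`, `i ∈ s`, of ideal sheaves on `X`, the support of the product `∏ i ∈ s, J i` is the union
of the supports of the factors. [folklore] -/
theorem stub_supportFinsetProd : ∀ (X : Scheme.{0}) (T : Type) (s : Finset T) (J : T → X.IdealSheafData),
    ((∏ i ∈ s, J i).support : Set X) = ⋃ i ∈ s, ((J i).support : Set X) := by
  intro X T s J
  classical
  induction s using Finset.induction_on with
  | empty =>
    rw [Finset.prod_empty, Scheme.IdealSheafData.one_eq_top, Scheme.IdealSheafData.support_top,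
      TopologicalSpace.Closeds.coe_bot]
    simp
  | insert a s ha ih =>
    rw [Finset.prod_insert ha, Scheme.IdealSheafData.support_mul,
      TopologicalSpace.Closeds.coe_sup, ih, Finset.set_biUnion_insert]

end Summit.ResolutionOfSingularities.ResolutionOfSingularities.Theorems.FInjectiveMacaulayfication.SupportFinsetProd

end
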